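import Mathlib
import HarnessLib
import Summits.NavierStokesRegularity.NavierStokesRegularity.Theorems.PoloidalWindowDoorLrcModEntireJetCertPsatzElimLazyCache
import Summits.NavierStokesRegularity.NavierStokesRegularity.Theorems.PoloidalWindowDoorLrcModEntireTHCertDecode
import Summits.NavierStokesRegularity.NavierStokesRegularity.Theorems.PoloidalWindowDoorLrcModEntireJetCertPsatzElimCellT1E5Q3GallC264Join
import Summits.NavierStokesRegularity.NavierStokesRegularity.Theorems.PoloidalWindowDoorLrcModEntireJetCertPsatzElimCellT1E5Q3GallS263
import Summits.NavierStokesRegularity.NavierStokesRegularity.Theorems.PoloidalWindowDoorLrcModEntireJetCertPsatzElimCellT1E5Q3GallS264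

/-!
# ARM-C cell T1′ (e,q) = (5,3), ALL real tilts γ ≠ 0 (C1b ∀γ, L = 8; eng-2 export j323178; LAZY port, prefetch split of step 264): cached lazy state 2 of the prefetch split of step 264 (generated by gen_prefetch.py)

WHAT THIS IS NOT: not a statement about Navier–Stokes; data/replay plumbing of an exact census row of an ansatz class (cell `ns-wall-extremal`, arm C, ns-wall-eng-6 g3). [folklore]
-/

noncomputable section

-- the summit and its single sub-problem share the name (CONVENTIONS §1), as in every Theorems file
set_option linter.dupNamespace false

namespace Summit.NavierStokesRegularity.NavierStokesRegularity.Theorems.PoloidalWindowDoorLrcModEntireJetCertPsatzElimCellT1E5Q3Gall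

open Literature.Analysis.ValidatedNumerics
open Summit.NavierStokesRegularity.NavierStokesRegularity.Theorems.PoloidalWindowDoorLrcModEntireJetCertPsatz
open Summit.NavierStokesRegularity.NavierStokesRegularity.Theorems.PoloidalWindowDoorLrcModEntireJetCertPsatzElim
open Summit.NavierStokesRegularity.NavierStokesRegularity.Theorems.PoloidalWindowDoorLrcModEntireJetCertPsatzElimHStage
open Summit.NavierStokesRegularity.NavierStokesRegularity.Theorems.PoloidalWindowDoorLrcModEntireJetCertPsatzElimLazy
open Summit.NavierStokesRegularity.NavierStokesRegularity.Theorems.PoloidalWindowDoorLrcModEntireJetCertPsatzElimLazyCache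
open Summit.NavierStokesRegularity.NavierStokesRegularity.Theorems.PoloidalWindowDoorLrcModEntireTHCertDecode

/-- CACHED LAZY STATE before step 264: base = `st263`, law 169 prefetched through the first 61 log entries (cache entries [61, 41]). [folklore] -/
def cS264p2 : CState := { base := st263, cache := [(169, 61, decodePoly 232 Summit.NavierStokesRegularity.NavierStokesRegularity.Theorems.PoloidalWindowDoorLrcModEntireJetCertPsatzElimCellT1E5Q3GallC264Join.cache_169_61Rows), (169, 41, decodePoly 232 Summit.NavierStokesRegularity.NavierStokesRegularity.Theorems.PoloidalWindowDoorLrcModEntireJetCertPsatzElimCellT1E5Q3GallC264Join.cache_169_41Rows)] }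

end Summit.NavierStokesRegularity.NavierStokesRegularity.Theorems.PoloidalWindowDoorLrcModEntireJetCertPsatzElimCellT1E5Q3Gall

end
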